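import Mathlib.Analysis.Calculus.FDeriv.Comp
import Mathlib.Analysis.Calculus.FDeriv.Add
import Mathlib.Analysis.Calculus.FDeriv.Linear
import Mathlib.Analysis.Calculus.Deriv.Comp
import Mathlib.Analysis.Calculus.Deriv.Add
import Mathlib.Analysis.Calculus.Deriv.Mul
import Mathlib.Analysis.Normed.Module.Basic
import Mathlib.Analysis.Complex.Basic
import HarnessLib

/-!
# Route `UnitScaleTilt`, crux K1 «MinimiserStabilityRegPr» (stmt-QuantumFields-19200), stub V2′ `stub_halvingStep`, C_E node after RULING g26-№6
# ((R1): the H-side chart of record is print's DOUBLE-BAR functional): **THE (149)–(155) INDUCTION OF [Balaban1985Averaging] PROP. 5 AS AN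
# ABSTRACT TOWER THEOREM** — the per-bond kernel of the composed chart remainder from (t) the one-step linear tube with its reader
# multiplicity, (r) the one-step remainder's ℓ¹-derivative bound (148), (s) GEOMETRIC level sizes; contraction constant `(2L−1)/L²`

Cell `ym3-torus` (HUMAN RULING D-0037: YM₃ on the torus is ladder rung R3, not the Clay problem), width seat `ym-ust-19936-w5` gen 3.
`--supports stmt-QuantumFields-19200 --as helper`; Mathlib-only, def-free, 0 sorry.

WHY.  RULING g26-№4∕№6: the per-bond kernel row (X2-C′-KERNEL) `‖∂_b C(j,c)[M]‖ ≤ C₃♭·ρ·η·(Lʲ)⁻²·‖M‖` is FALSE for the single-bar chart `chartLog` (j-flat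
second-order gauge-covariance term at base-point bonds) and is to be proved for the double-bar chart `chartLogFlat` of (S1).  Print's proof is the induction
(149)–(155) pp.40–41 through the recursion (152) `C_{j+1} = LQ·C_j(L⁻¹·) + C(·, L⁻¹Q_j + C_j(L⁻¹·))`.  In the weighted-ball currency of the T³ letters a NAIVE
sup-induction over levels does not close: the two level-m bonds parallel to `c` that read the fine bond `b` enter the tube `L·Q` with total multiplicity
`2o + 1 ≤ 2L − 1`, which overshoots the tube rate `L^{1−d}` by `(2 − 1/L)` per level.  Print closes because the INNER remainder sees the field one level finer
(`|L⁻¹A| = L⁻¹|A|`): with the hypothesis in print's shape `K_m ≤ κ_m·s_m·α_m` — `s_m` the level-`m` field size (GEOMETRIC, `L·s_m ≤ s_{m+1}`), `α_m` the tube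
kernel scale (`α_{m+1} = λ·α_m`, `λ = L^{1−d}`) — the recursion is `κ_{m+1} ≤ θ·κ_m + A′·(1 + κ_m s_m)` with `θ = (2L−1)L^{−d}/(Lλ) = (2L−1)/L² ≤ 3/4`, exactly
b07's «(2L−1)/L² + (16dC₁Lᵈ/C₃)(1 + C₃Lʲb) ≤ ¾ + ¼» (`B7Prop5Flat.prop5_flat_induction`, ℤᵈ objects).  This file isolates that mechanism from every lattice object.
WHAT (abstract; finite index types `ι m` per level, values in a seminormed group ∕ normed ℂ-space `𝔸`):
* §1 `kernel_step_bound` (+ `tube_bound_of_kernel`, `sum_norm_le_of_vanish` feeding its two hypotheses) — one level: from the pointwise recursion `k′ = T k + E (a + k)`, a tube bound `‖T w c‖ ≤ θ₀·sup_S ‖w‖` for `w` supported on the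
  reader set `S`, an ℓ¹-derivative bound `‖E w c‖ ≤ G·s·Σ_{S}‖w‖` ((148)), `|S| ≤ ν`, `‖a‖ ≤ α`, `‖k‖ ≤ B` on `S`: `‖k′ c‖ ≤ θ₀B + Gν·s·(α + B)`.
* §2 `step_profile`, `kernel_tower_bound` — the induction (149)→(155): with `L·s_m ≤ s_{m+1}`, `α_{m+1} = λα_m`, `θ₀ ≤ θ·Lλ`, `Gν ≤ A′·Lλ`, `A′·s_m ≤ δ`
  (`m < J`), `θ + δ < 1`, `k_0 = 0`: **`‖k_m c‖ ≤ (A′/(1 − θ − δ))·s_m·α_m` for all `m ≤ J`** — uniform in `J`.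
* §3 `exists_tower_hasDerivAt` ∕ `tower_deriv_recursion` — the recursion ITSELF from the chain rule: for one-step maps `Φ_m` with continuous linear parts `T_m`,
  the orbit `V_{m+1}(t) = Φ_m(V_m(t))` of an affine level-0 curve `V_0(t) = V₀ + t•D₀`, and `Φ_m` differentiable at the orbit points: `t ↦ V_m(t)` is
  differentiable at `0`, `V̇_{m+1} = DΦ_m(V_m(0))[V̇_m]`, and `k_m := V̇_m − Lin_m D₀` (`Lin_{m+1} = T_m ∘ Lin_m`) satisfies
  `k_{m+1} = T_m k_m + D(Φ_m − T_m)(V_m(0))[Lin_m D₀ + k_m]` — hypothesis `hrec` of §2 ((153)).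
HONEST SCOPE.  Lattice-free bookkeeping + calculus; the one-step inputs (tube multiplicity `2L−1`, reader count `2d`, (148) via ✓`B7Ineq148.norm_fderiv_apply_le_sum`,
the geometric sizes on the read cone, locality) are supplied by the instantiation for `chartLogFlat` ((S1)∕(S3)∕(S4) of RULING g26-№6).  NOT a claim about the stub,
the crux, the rung or the mass gap.

References: T. Bałaban, CMP **98** (1985) 17–51 [Balaban1985Averaging] ((148)–(155) pp.40–41, Prop. 5 (156)–(157) p.42); CMP **102** (1985) 277–309
[Balaban1985Variational] ((44)–(49) p.285, (72)–(73) p.289).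
-/

noncomputable section

open scoped BigOperators

namespace Summit.QuantumFields.YangMills.Theorems.ChartKernelTower

/-! ## §1 One level: tube + (148) -/

section Step

variable {ι ι' : Type*} {𝔸 : Type*} [SeminormedAddCommGroup 𝔸]

/-- **ONE LEVEL OF (153)–(154).**  If `k′ c = T k c + E (a + k) c`, the tube satisfies `‖T w c‖ ≤ θ₀·β` for every `w` vanishing off the reader set `S` with
`‖w‖ ≤ β` on `S`, the remainder derivative satisfies the ℓ¹-bound `‖E w c‖ ≤ G·s·Σ_{c′∈S}‖w c′‖` for `w` vanishing off `S`, `|S| ≤ ν`, and `a`, `k` vanish off `S`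
with `‖a c′‖ ≤ α`, `‖k c′‖ ≤ B` there, then `‖k′ c‖ ≤ θ₀·B + G·ν·s·(α + B)`. [cite: Balaban1985Averaging, (153)-(154) p.41] -/
theorem kernel_step_bound (S : Finset ι) (T E : (ι → 𝔸) → ι' → 𝔸) (a k : ι → 𝔸) (k' : ι' → 𝔸) (c : ι')
    {θ₀ G s α B : ℝ} {ν : ℕ} (hG : 0 ≤ G) (hs : 0 ≤ s) (hα : 0 ≤ α) (hB : 0 ≤ B)
    (hrec : k' c = T k c + E (fun c' => a c' + k c') c)
    (hT : ∀ (w : ι → 𝔸) (β : ℝ), 0 ≤ β → (∀ c', c' ∉ S → w c' = 0) → (∀ c' ∈ S, ‖w c'‖ ≤ β) → ‖T w c‖ ≤ θ₀ * β)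
    (hE : ∀ w : ι → 𝔸, (∀ c', c' ∉ S → w c' = 0) → ‖E w c‖ ≤ G * s * ∑ c' ∈ S, ‖w c'‖)
    (hcard : S.card ≤ ν) (hSa : ∀ c', c' ∉ S → a c' = 0) (hSk : ∀ c', c' ∉ S → k c' = 0)
    (ha : ∀ c' ∈ S, ‖a c'‖ ≤ α) (hk : ∀ c' ∈ S, ‖k c'‖ ≤ B) :
    ‖k' c‖ ≤ θ₀ * B + G * ν * s * (α + B) := by
  rw [hrec]
  refine (norm_add_le _ _).trans (add_le_add ?_ ?_)
  · exact hT k B hB hSk hk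
  · have hw0 : ∀ c', c' ∉ S → (fun c' => a c' + k c') c' = 0 := fun c' hc' => by
      simp only [hSa c' hc', hSk c' hc', add_zero]
    refine (hE _ hw0).trans ?_
    have hsum : ∑ c' ∈ S, ‖a c' + k c'‖ ≤ ∑ c' ∈ S, (α + B) :=
      Finset.sum_le_sum fun c' hc' => (norm_add_le _ _).trans (add_le_add (ha c' hc') (hk c' hc'))
    rw [Finset.sum_const, nsmul_eq_mul] at hsum
    have hcard' : (S.card : ℝ) * (α + B) ≤ ν * (α + B) :=
      mul_le_mul_of_nonneg_right (by exact_mod_cast hcard) (add_nonneg hα hB)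
    calc G * s * ∑ c' ∈ S, ‖a c' + k c'‖ ≤ G * s * (ν * (α + B)) :=
          mul_le_mul_of_nonneg_left (hsum.trans hcard') (mul_nonneg hG hs)
      _ = G * ν * s * (α + B) := by ring


/-- The tube hypothesis of `kernel_step_bound` from a PER-COORDINATE kernel: if `‖T w c‖ ≤ Σ_{c′} τ c′·‖w c′‖` with `τ ≥ 0` and the kernel mass on the reader set
is `Σ_{c′∈S} τ c′ ≤ θ₀` (print's multiplicity count `2o + 1 ≤ 2L − 1` of the two parallel readers, times `L^{−d}`), then `‖T w c‖ ≤ θ₀·β` for every `w` vanishing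
off `S` with `‖w‖ ≤ β` on `S`. [cite: Balaban1985Averaging, (142) p.39, (154) p.41] -/
theorem tube_bound_of_kernel [Fintype ι] (S : Finset ι) (T : (ι → 𝔸) → ι' → 𝔸) (c : ι') (τ : ι → ℝ) {θ₀ : ℝ}
    (hτ : ∀ c', 0 ≤ τ c') (hTk : ∀ w : ι → 𝔸, ‖T w c‖ ≤ ∑ c', τ c' * ‖w c'‖) (hmass : ∑ c' ∈ S, τ c' ≤ θ₀)
    (w : ι → 𝔸) (β : ℝ) (hβ : 0 ≤ β) (hw : ∀ c', c' ∉ S → w c' = 0) (hwβ : ∀ c' ∈ S, ‖w c'‖ ≤ β) :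
    ‖T w c‖ ≤ θ₀ * β := by
  refine (hTk w).trans ?_
  have hvan : ∀ c' ∈ (Finset.univ : Finset ι), c' ∉ S → τ c' * ‖w c'‖ = 0 := fun c' _ hc' => by
    rw [hw c' hc', norm_zero, mul_zero]
  rw [← Finset.sum_subset (Finset.subset_univ S) hvan]
  calc ∑ c' ∈ S, τ c' * ‖w c'‖ ≤ ∑ c' ∈ S, τ c' * β :=
        Finset.sum_le_sum fun c' hc' => mul_le_mul_of_nonneg_left (hwβ c' hc') (hτ c')
    _ = (∑ c' ∈ S, τ c') * β := by rw [Finset.sum_mul]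
    _ ≤ θ₀ * β := mul_le_mul_of_nonneg_right hmass hβ

/-- For `w` vanishing off `S`, its ℓ¹-mass on ANY finite set is at most its ℓ¹-mass on `S` (used to pass from the one-step remainder's own read set to the
reader set of the fine bond in the (148)-hypothesis of `kernel_step_bound`). [folklore] -/
theorem sum_norm_le_of_vanish [DecidableEq ι] (S U : Finset ι) (w : ι → 𝔸) (hw : ∀ c', c' ∉ S → w c' = 0) :
    ∑ c' ∈ U, ‖w c'‖ ≤ ∑ c' ∈ S, ‖w c'‖ := by
  have h1 : ∑ c' ∈ U.filter (· ∈ S), ‖w c'‖ = ∑ c' ∈ U, ‖w c'‖ :=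
    Finset.sum_filter_of_ne fun c' _ hne => by
      by_contra hc'
      exact hne (by rw [hw c' hc', norm_zero])
  rw [← h1]
  exact Finset.sum_le_sum_of_subset_of_nonneg (fun c' hc' => (Finset.mem_filter.mp hc').2) fun _ _ _ => norm_nonneg _

end Step

/-! ## §2 The induction (149)→(155): geometric sizes give the contraction `(2L−1)/L²` -/

section Tower

/-- **THE REAL INEQUALITY BEHIND (155)**: with `κ⋆ = A′/(1−θ−δ)`, `L·s ≤ s′`, `α′ = λα`, `θ₀ ≤ θ·Lλ`, `Γ ≤ A′·Lλ`, `A′s ≤ δ`, `θ + δ < 1` (all quantities `≥ 0`):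
`θ₀·(κ⋆sα) + Γ·s·(α + κ⋆sα) ≤ κ⋆·s′·α′` — because `κ⋆(θ + δ) + A′ = κ⋆`. [cite: Balaban1985Averaging, (154)-(155) p.41] -/
theorem step_profile {θ₀ Γ L lam θ A' δ s s' α α' : ℝ}
    (hA' : 0 ≤ A') (hθδ : θ + δ < 1) (hlam : 0 ≤ lam) (hL : 0 ≤ L)
    (hs0 : 0 ≤ s) (hα0 : 0 ≤ α) (hs : L * s ≤ s') (hα : α' = lam * α)
    (hθ : θ₀ ≤ θ * (L * lam)) (hΓ : Γ ≤ A' * (L * lam)) (hsmall : A' * s ≤ δ) :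
    θ₀ * (A' / (1 - θ - δ) * s * α) + Γ * s * (α + A' / (1 - θ - δ) * s * α) ≤ A' / (1 - θ - δ) * s' * α' := by
  set κ : ℝ := A' / (1 - θ - δ) with hκ
  have h1 : 0 < 1 - θ - δ := by linarith
  have hκ0 : 0 ≤ κ := div_nonneg hA' h1.le
  have hκeq : κ * (θ + δ) + A' = κ := by rw [hκ]; field_simp; ring
  have hsa : 0 ≤ s * α := mul_nonneg hs0 hα0
  have hLlam : 0 ≤ L * lam := mul_nonneg hL hlam
  have hcollect : θ₀ * (κ * s * α) + Γ * s * (α + κ * s * α) = s * α * (θ₀ * κ + Γ * (1 + κ * s)) := by ring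
  have h2 : 0 ≤ 1 + κ * s := by have := mul_nonneg hκ0 hs0; linarith
  have hbr : θ₀ * κ + Γ * (1 + κ * s) ≤ (L * lam) * (θ * κ + A' * (1 + κ * s)) := by
    calc θ₀ * κ + Γ * (1 + κ * s) ≤ θ * (L * lam) * κ + A' * (L * lam) * (1 + κ * s) :=
          add_le_add (mul_le_mul_of_nonneg_right hθ hκ0) (mul_le_mul_of_nonneg_right hΓ h2)
      _ = (L * lam) * (θ * κ + A' * (1 + κ * s)) := by ring
  have hinner : θ * κ + A' * (1 + κ * s) ≤ κ := by
    have h3 : A' * (κ * s) ≤ δ * κ := by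
      calc A' * (κ * s) = (A' * s) * κ := by ring
        _ ≤ δ * κ := mul_le_mul_of_nonneg_right hsmall hκ0
    calc θ * κ + A' * (1 + κ * s) = θ * κ + A' + A' * (κ * s) := by ring
      _ ≤ θ * κ + A' + δ * κ := by linarith
      _ = κ * (θ + δ) + A' := by ring
      _ = κ := hκeq
  have hsα : (L * lam) * (s * α) ≤ s' * α' := by
    rw [hα]
    calc L * lam * (s * α) = (L * s) * (lam * α) := by ring
      _ ≤ s' * (lam * α) := mul_le_mul_of_nonneg_right hs (mul_nonneg hlam hα0)
  calc θ₀ * (κ * s * α) + Γ * s * (α + κ * s * α) = s * α * (θ₀ * κ + Γ * (1 + κ * s)) := hcollect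
    _ ≤ s * α * ((L * lam) * (θ * κ + A' * (1 + κ * s))) := mul_le_mul_of_nonneg_left hbr hsa
    _ ≤ s * α * ((L * lam) * κ) := mul_le_mul_of_nonneg_left (mul_le_mul_of_nonneg_left hinner hLlam) hsa
    _ = (L * lam) * (s * α) * κ := by ring
    _ ≤ s' * α' * κ := mul_le_mul_of_nonneg_right hsα hκ0
    _ = κ * s' * α' := by ring

variable {𝔸 : Type*} [SeminormedAddCommGroup 𝔸]

/-- **THE (149)→(155) INDUCTION, ABSTRACT.**  Levels `m ≤ J` with index types `ι m`; responses `k_m, a_m : ι m → 𝔸` (remainder ∕ linear-tube response to one fine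
bond direction) vanishing off the finite reader sets `S m` (`|S m| ≤ ν`), with the recursion `k_{m+1} c = T_m k_m c + E_m (a_m + k_m) c` on `S (m+1)` ((153));
tube bound `θ₀` and ℓ¹-derivative bound `G·s_m` ((148)) as in `kernel_step_bound`, required only at readers `c ∈ S (m+1)`; `‖a_m‖ ≤ α_m`, `α_{m+1} = λα_m`;
GEOMETRIC sizes `L·s_m ≤ s_{m+1}`; `θ₀ ≤ θ·Lλ`, `Gν ≤ A′·Lλ`, `A′s_m ≤ δ` (`m < J`), `θ + δ < 1`; `k_0 = 0`.  Then **`‖k_m c‖ ≤ (A′/(1−θ−δ))·s_m·α_m`** for all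
`m ≤ J` and all `c`, uniformly in `J`.  (For the double-bar tube in `d` dimensions: `θ₀ = (2L−1)L^{−d}`, `λ = L^{1−d}`, `θ = (2L−1)/L² ≤ 3/4`, `L ≥ 2`.)
[cite: Balaban1985Averaging, (149)-(155) pp.40-41] -/
theorem kernel_tower_bound (J : ℕ) (ι : ℕ → Type*) (k a : (m : ℕ) → ι m → 𝔸) (T E : (m : ℕ) → (ι m → 𝔸) → ι (m + 1) → 𝔸)
    (S : (m : ℕ) → Finset (ι m)) (s α : ℕ → ℝ) {θ₀ G L lam θ A' δ : ℝ} {ν : ℕ}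
    (hA' : 0 ≤ A') (hθδ : θ + δ < 1) (hlam : 0 ≤ lam) (hL : 0 ≤ L) (hG : 0 ≤ G)
    (hs0 : ∀ m, 0 ≤ s m) (hα0 : ∀ m, 0 ≤ α m)
    (hs : ∀ m, m < J → L * s m ≤ s (m + 1)) (hα : ∀ m, m < J → α (m + 1) = lam * α m)
    (hθ : θ₀ ≤ θ * (L * lam)) (hGν : G * ν ≤ A' * (L * lam)) (hsmall : ∀ m, m < J → A' * s m ≤ δ)
    (hk0 : ∀ c, k 0 c = 0)
    (hrec : ∀ m, m < J → ∀ c ∈ S (m + 1), k (m + 1) c = T m (k m) c + E m (fun c' => a m c' + k m c') c)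
    (hT : ∀ m, m < J → ∀ c ∈ S (m + 1), ∀ (w : ι m → 𝔸) (β : ℝ), 0 ≤ β → (∀ c', c' ∉ S m → w c' = 0) →
      (∀ c' ∈ S m, ‖w c'‖ ≤ β) → ‖T m w c‖ ≤ θ₀ * β)
    (hE : ∀ m, m < J → ∀ c ∈ S (m + 1), ∀ w : ι m → 𝔸, (∀ c', c' ∉ S m → w c' = 0) → ‖E m w c‖ ≤ G * s m * ∑ c' ∈ S m, ‖w c'‖)
    (hcard : ∀ m, (S m).card ≤ ν) (hSa : ∀ m c', c' ∉ S m → a m c' = 0) (hSk : ∀ m c', c' ∉ S m → k m c' = 0)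
    (ha : ∀ m, ∀ c' ∈ S m, ‖a m c'‖ ≤ α m) :
    ∀ m, m ≤ J → ∀ c, ‖k m c‖ ≤ A' / (1 - θ - δ) * s m * α m := by
  have h1 : 0 < 1 - θ - δ := by linarith
  have hκ0 : 0 ≤ A' / (1 - θ - δ) := div_nonneg hA' h1.le
  intro m
  induction m with
  | zero =>
    intro _ c
    rw [hk0 c, norm_zero]
    exact mul_nonneg (mul_nonneg hκ0 (hs0 0)) (hα0 0)
  | succ m ih =>
    intro hm c
    have hm' : m < J := Nat.lt_of_succ_le hm
    have hB : ∀ c' ∈ S m, ‖k m c'‖ ≤ A' / (1 - θ - δ) * s m * α m := fun c' _ => ih hm'.le c'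
    have hBnn : 0 ≤ A' / (1 - θ - δ) * s m * α m := mul_nonneg (mul_nonneg hκ0 (hs0 m)) (hα0 m)
    by_cases hc : c ∈ S (m + 1)
    · have hstep := kernel_step_bound (S m) (T m) (E m) (a m) (k m) (k (m + 1)) c (ν := ν) hG (hs0 m) (hα0 m) hBnn
        (hrec m hm' c hc) (hT m hm' c hc) (hE m hm' c hc) (hcard m) (hSa m) (hSk m) (ha m) hB
      refine hstep.trans ?_
      have hprof := step_profile (θ₀ := θ₀) (Γ := G * ν) (L := L) (lam := lam) (θ := θ) (A' := A') (δ := δ) (s := s m) (s' := s (m + 1))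
        (α := α m) (α' := α (m + 1)) hA' hθδ hlam hL (hs0 m) (hα0 m) (hs m hm') (hα m hm') hθ hGν (hsmall m hm')
      calc θ₀ * (A' / (1 - θ - δ) * s m * α m) + G * ν * s m * (α m + A' / (1 - θ - δ) * s m * α m)
          = θ₀ * (A' / (1 - θ - δ) * s m * α m) + G * ν * s m * (α m + A' / (1 - θ - δ) * s m * α m) := rfl
        _ ≤ A' / (1 - θ - δ) * s (m + 1) * α (m + 1) := by
            have := hprof
            simpa [mul_assoc] using this
    · rw [hSk (m + 1) c hc, norm_zero]
      exact mul_nonneg (mul_nonneg hκ0 (hs0 (m + 1))) (hα0 (m + 1))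

/-- **THE (149)→(155) INDUCTION WITH EVERY LETTER ASKED ONLY UP TO THE TOP LEVEL `J`** (v1.1, append-only): same statement and proof as `kernel_tower_bound`, but the support,
count and size hypotheses `hcard`, `hSa`, `hSk`, `ha` are required only for the levels `m ≤ J` that the induction visits (the lattice letters exist only in the standing range
`m ≤ m_P + K_P`). [cite: Balaban1985Averaging, (149)-(155) pp.40-41] -/
theorem kernel_tower_bound_le (J : ℕ) (ι : ℕ → Type*) (k a : (m : ℕ) → ι m → 𝔸) (T E : (m : ℕ) → (ι m → 𝔸) → ι (m + 1) → 𝔸)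
    (S : (m : ℕ) → Finset (ι m)) (s α : ℕ → ℝ) {θ₀ G L lam θ A' δ : ℝ} {ν : ℕ}
    (hA' : 0 ≤ A') (hθδ : θ + δ < 1) (hlam : 0 ≤ lam) (hL : 0 ≤ L) (hG : 0 ≤ G)
    (hs0 : ∀ m, 0 ≤ s m) (hα0 : ∀ m, 0 ≤ α m)
    (hs : ∀ m, m < J → L * s m ≤ s (m + 1)) (hα : ∀ m, m < J → α (m + 1) = lam * α m)
    (hθ : θ₀ ≤ θ * (L * lam)) (hGν : G * ν ≤ A' * (L * lam)) (hsmall : ∀ m, m < J → A' * s m ≤ δ)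
    (hk0 : ∀ c, k 0 c = 0)
    (hrec : ∀ m, m < J → ∀ c ∈ S (m + 1), k (m + 1) c = T m (k m) c + E m (fun c' => a m c' + k m c') c)
    (hT : ∀ m, m < J → ∀ c ∈ S (m + 1), ∀ (w : ι m → 𝔸) (β : ℝ), 0 ≤ β → (∀ c', c' ∉ S m → w c' = 0) →
      (∀ c' ∈ S m, ‖w c'‖ ≤ β) → ‖T m w c‖ ≤ θ₀ * β)
    (hE : ∀ m, m < J → ∀ c ∈ S (m + 1), ∀ w : ι m → 𝔸, (∀ c', c' ∉ S m → w c' = 0) → ‖E m w c‖ ≤ G * s m * ∑ c' ∈ S m, ‖w c'‖)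
    (hcard : ∀ m, m < J → (S m).card ≤ ν) (hSa : ∀ m, m < J → ∀ c', c' ∉ S m → a m c' = 0)
    (hSk : ∀ m, m ≤ J → ∀ c', c' ∉ S m → k m c' = 0) (ha : ∀ m, m < J → ∀ c' ∈ S m, ‖a m c'‖ ≤ α m) :
    ∀ m, m ≤ J → ∀ c, ‖k m c‖ ≤ A' / (1 - θ - δ) * s m * α m := by
  have h1 : 0 < 1 - θ - δ := by linarith
  have hκ0 : 0 ≤ A' / (1 - θ - δ) := div_nonneg hA' h1.le
  intro m
  induction m with
  | zero =>
    intro _ c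
    rw [hk0 c, norm_zero]
    exact mul_nonneg (mul_nonneg hκ0 (hs0 0)) (hα0 0)
  | succ m ih =>
    intro hm c
    have hm' : m < J := Nat.lt_of_succ_le hm
    have hB : ∀ c' ∈ S m, ‖k m c'‖ ≤ A' / (1 - θ - δ) * s m * α m := fun c' _ => ih hm'.le c'
    have hBnn : 0 ≤ A' / (1 - θ - δ) * s m * α m := mul_nonneg (mul_nonneg hκ0 (hs0 m)) (hα0 m)
    by_cases hc : c ∈ S (m + 1)
    · have hstep := kernel_step_bound (S m) (T m) (E m) (a m) (k m) (k (m + 1)) c (ν := ν) hG (hs0 m) (hα0 m) hBnn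
        (hrec m hm' c hc) (hT m hm' c hc) (hE m hm' c hc) (hcard m hm') (hSa m hm') (hSk m hm'.le) (ha m hm') hB
      refine hstep.trans ?_
      have hprof := step_profile (θ₀ := θ₀) (Γ := G * ν) (L := L) (lam := lam) (θ := θ) (A' := A') (δ := δ) (s := s m) (s' := s (m + 1))
        (α := α m) (α' := α (m + 1)) hA' hθδ hlam hL (hs0 m) (hα0 m) (hs m hm') (hα m hm') hθ hGν (hsmall m hm')
      calc θ₀ * (A' / (1 - θ - δ) * s m * α m) + G * ν * s m * (α m + A' / (1 - θ - δ) * s m * α m)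
          = θ₀ * (A' / (1 - θ - δ) * s m * α m) + G * ν * s m * (α m + A' / (1 - θ - δ) * s m * α m) := rfl
        _ ≤ A' / (1 - θ - δ) * s (m + 1) * α (m + 1) := by
            have := hprof
            simpa [mul_assoc] using this
    · rw [hSk (m + 1) hm c hc, norm_zero]
      exact mul_nonneg (mul_nonneg hκ0 (hs0 (m + 1))) (hα0 (m + 1))

end Tower

/-! ## §3 The recursion (153) from the chain rule along the orbit of an affine level-0 curve -/

section Deriv

variable {𝔸 : Type*} [NormedAddCommGroup 𝔸] [NormedSpace ℂ 𝔸] (ι : ℕ → Type*) [∀ m, Fintype (ι m)]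

/-- **THE ORBIT OF AN AFFINE CURVE UNDER A TOWER OF DIFFERENTIABLE ONE-STEP MAPS IS DIFFERENTIABLE AT `t = 0`, WITH THE CHAIN-RULE DERIVATIVES**:
`V_0(t) = V₀ + t•D₀`, `V_{m+1}(t) = Φ_m(V_m(t))`, `Φ_m` differentiable at `V_m(0)` for `m < J` ⇒ there are `V̇_m` with `V̇_0 = D₀`,
`V̇_{m+1} = DΦ_m(V_m(0))[V̇_m]` and `HasDerivAt V_m V̇_m 0` for all `m ≤ J` ((137): `d/dt F(A + tδA)|_{t=0}`). [cite: Balaban1985Averaging, (137) p.39, (153) p.41] -/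
theorem exists_tower_hasDerivAt (J : ℕ) (Φ : (m : ℕ) → (ι m → 𝔸) → (ι (m + 1) → 𝔸)) (V : (m : ℕ) → ℂ → (ι m → 𝔸)) (V₀ D₀ : ι 0 → 𝔸)
    (hV0 : ∀ t, V 0 t = V₀ + t • D₀) (hVs : ∀ m t, V (m + 1) t = Φ m (V m t))
    (hΦ : ∀ m, m < J → DifferentiableAt ℂ (Φ m) (V m 0)) :
    ∃ vd : (m : ℕ) → (ι m → 𝔸), vd 0 = D₀ ∧ (∀ m, m < J → vd (m + 1) = fderiv ℂ (Φ m) (V m 0) (vd m)) ∧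
      ∀ m, m ≤ J → HasDerivAt (V m) (vd m) 0 := by
  let vd : (m : ℕ) → (ι m → 𝔸) := fun m => Nat.rec (motive := fun m => ι m → 𝔸) D₀ (fun m v => fderiv ℂ (Φ m) (V m 0) v) m
  refine ⟨vd, rfl, fun m _ => rfl, ?_⟩
  intro m
  induction m with
  | zero =>
    intro _
    have hV : V 0 = fun t => V₀ + t • D₀ := funext hV0
    have hvd : vd 0 = D₀ := rfl
    rw [hV, hvd]
    have h : HasDerivAt (fun t : ℂ => V₀ + t • D₀) ((1 : ℂ) • D₀) 0 := ((hasDerivAt_id (0 : ℂ)).smul_const D₀).const_add V₀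
    rwa [one_smul] at h
  | succ m ih =>
    intro hm
    have hm' : m < J := Nat.lt_of_succ_le hm
    have hV : V (m + 1) = Φ m ∘ V m := funext fun t => hVs m t
    rw [hV]
    have hcomp := (hΦ m hm').hasFDerivAt.comp_hasDerivAt (0 : ℂ) (ih hm'.le)
    exact hcomp

/-- **THE RECURSION (153) FOR THE REMAINDER RESPONSE.**  In the setting of `exists_tower_hasDerivAt`, let `T_m` be continuous linear (the one-step tube) and
`Lin_0 = id`, `Lin_{m+1} = T_m ∘ Lin_m` (the composed tube); put `a_m := Lin_m D₀` and `k_m := V̇_m − a_m` (the remainder response, `C_m = V_m − Lin_m V_0`).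
Then `k_0 = 0` and, for `m < J`, **`k_{m+1} = T_m k_m + D(Φ_m − T_m)(V_m(0))[a_m + k_m]`** — the hypothesis `hrec` of `kernel_tower_bound`, with
`E_m := D(Φ_m − T_m)(V_m(0))` the derivative of the one-step REMAINDER at the orbit point. [cite: Balaban1985Averaging, (152)-(153) p.41] -/
theorem tower_deriv_recursion (J : ℕ) (Φ : (m : ℕ) → (ι m → 𝔸) → (ι (m + 1) → 𝔸)) (T : (m : ℕ) → (ι m → 𝔸) →L[ℂ] (ι (m + 1) → 𝔸))
    (Lin : (m : ℕ) → (ι 0 → 𝔸) →L[ℂ] (ι m → 𝔸)) (hLin0 : Lin 0 = ContinuousLinearMap.id ℂ (ι 0 → 𝔸)) (hLins : ∀ m, Lin (m + 1) = (T m).comp (Lin m))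
    (V : (m : ℕ) → ℂ → (ι m → 𝔸)) (V₀ D₀ : ι 0 → 𝔸) (hV0 : ∀ t, V 0 t = V₀ + t • D₀) (hVs : ∀ m t, V (m + 1) t = Φ m (V m t))
    (hΦ : ∀ m, m < J → DifferentiableAt ℂ (Φ m) (V m 0)) :
    ∃ vd : (m : ℕ) → (ι m → 𝔸), (∀ m, m ≤ J → HasDerivAt (V m) (vd m) 0) ∧ (vd 0 - Lin 0 D₀ = 0) ∧
      ∀ m, m < J → ∀ c, (vd (m + 1) - Lin (m + 1) D₀) c =
        T m (vd m - Lin m D₀) c + fderiv ℂ (fun W => Φ m W - T m W) (V m 0) (fun c' => Lin m D₀ c' + (vd m - Lin m D₀) c') c := by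
  obtain ⟨vd, hvd0, hvds, hder⟩ := exists_tower_hasDerivAt ι J Φ V V₀ D₀ hV0 hVs hΦ
  refine ⟨vd, hder, by rw [hvd0, hLin0]; simp, fun m hm c => ?_⟩
  have hfd : fderiv ℂ (fun W => Φ m W - T m W) (V m 0) = fderiv ℂ (Φ m) (V m 0) - T m :=
    ((hΦ m hm).hasFDerivAt.sub (T m).hasFDerivAt).fderiv
  have hsum : (fun c' => Lin m D₀ c' + (vd m - Lin m D₀) c') = vd m := by
    funext c'; simp
  rw [hsum, hfd, hvds m hm, hLins m]
  simp only [FunLike.coe_sub, Pi.sub_apply, ContinuousLinearMap.coe_comp, Function.comp_apply, map_sub]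
  abel

end Deriv

end Summit.QuantumFields.YangMills.Theorems.ChartKernelTower

end
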